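import Mathlib
import HarnessLib
import Summits.HubbardSuperconductivity.HubbardSuperconductivity.Theses.DeformationLadder
import Summits.HubbardSuperconductivity.HubbardSuperconductivity.Theorems.WeakCouplingBCSWcbcsBcsConstructionFreeSourcedGroundEnergy
import Summits.HubbardSuperconductivity.HubbardSuperconductivity.Theorems.WeakCouplingBCSWcbcsBcsConstructionDWaveCooperSumLowerBound
import Summits.HubbardSuperconductivity.HubbardSuperconductivity.Theorems.ThermalWedgeTwTipContinuationEdgeOrderTorusTrig

/-!
# Route `DeformationLadder`, support `FreeCooperLogarithm` (item `stmt-HubbardSuperconductivity-1898`)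

THE FREE COOPER LOGARITHM of the `d`-wave-sourced `U = 0` Hubbard torus: for every chemical potential
strictly inside the band, `μ ∈ (-4, 4)`, and every `g > 0` there are `h₀ > 0`, `ε > 0`, `L₀` with

`E₀(dWaveSourceTorus L 0 μ h₀) + (h₀²/g + ε) L² ≤ E₀(dWaveSourceTorus L 0 μ 0)` for all `L ≥ L₀`

(`freeCooperLogarithm_proof`), `E₀ = Matrix.groundEnergy` on the full Fock space.

## Proof

* The operator side is the tree's closed BdG formula
  `E₀(dWaveSourceTorus L 0 μ s) = Σ_k (ξ_k − √(ξ_k² + 8 s² ĝ_d(k)²))`, `ξ_k = ε_L(k) − μ`, `L ≥ 3`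
  (`stub_freeSourcedGroundEnergy`, Theorems/WeakCouplingBCSWcbcsBcsConstructionFreeSourcedGroundEnergy),
  so the energy gain is `E₀(0) − E₀(h) = Σ_k [√(ξ_k² + 8h²ĝ_d(k)²) − |ξ_k|]`.
* Per mode, `√(ξ² + D²) − |ξ| = D²/(√(ξ²+D²) + |ξ|) ≥ D²/(2√(ξ² + M²))` for `D² ≤ M²` (`bdgGain_ge`); with
  `D² = 8h²ĝ_d² ≤ 32h² = M²` the gain is `≥ 4h² Σ_k ĝ_d(k)²/√(ξ_k² + (4√2 h)²)`.
* The `d`-wave-weighted, `h`-regulated Cooper logarithm on the torus for EVERY `μ ∈ (-4,4)` and every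
  (also odd) side `L`: `Σ_k ĝ_d(k)²/√(ξ_k² + h²) ≥ c(μ) log(1/h) L²` eventually in `L`
  (`dWaveCooperSum_ge_of_mem_Ioo`). The tree's `stub_dWaveCooperSumLowerBound` covers `μ ∈ (-4,0)`
  (antinodal rows near `k₂ = 0`); here the same one-row harmonic walk `dWaveCooperRow_sum_ge` is summed
  over the `≥ s²L/(32π)` rows of a window `cos k₂ ∈ [a, a + s²/8]` (`card_windowRows_ge`) placed at
  `a = -μ/4 + r/2`, `r = min(4+μ, 4-μ)/8`, `s = r/2`, `κ = r/4`: every such row crosses the Fermi level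
  transversally (`|2cos k₂ + μ| ≤ 2 − s²/2`) and carries `ĝ_d ≤ −2κ` wherever `ε ≥ μ` on it.
* Choice of the source: `K = (1/g + 1)/(4c)`, `h' = min(e^{−K}, h₁/2)`, `h₀ = h'/(4√2)`, `ε = h₀²`; then
  `4h₀² c log(1/h') ≥ h₀²(1/g + 1)`.

Sources: the Cooper logarithm is folklore (Salmhofer, *Renormalization* (1999) §4.5.4 for its thermal
form; Bardeen–Cooper–Schrieffer 1957 §III); the sign of the BCS gain functional,
Hainzl–Hamza–Seiringer–Solovej, Comm. Math. Phys. 281 (2008) 349. No definition and no named fact.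
-/

noncomputable section

namespace Summit.HubbardSuperconductivity.DeformationLadder

open Real Finset
open Literature.MathematicalPhysics.QuantumLattice Literature.Probability.LatticeModels
open Summit.HubbardSuperconductivity.HubbardSuperconductivity.Theses.DeformationLadder
open Summit.HubbardSuperconductivity.HubbardSuperconductivity.Theorems
open Summit.HubbardSuperconductivity.TwTipContinuation.IsogapTransport

/-! ### Per-mode algebra -/

/-- The BdG gain of one mode dominates its Cooper-regulated second-order term: for `0 < M` and
`D² ≤ M²`, `D²/(2√(ξ² + M²)) ≤ √(ξ² + D²) − |ξ|`. [folklore] -/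
theorem bdgGain_ge {ξ D M : ℝ} (hM : 0 < M) (hDM : D ^ 2 ≤ M ^ 2) :
    D ^ 2 / (2 * Real.sqrt (ξ ^ 2 + M ^ 2)) ≤ Real.sqrt (ξ ^ 2 + D ^ 2) - |ξ| := by
  set A := Real.sqrt (ξ ^ 2 + D ^ 2) with hA
  set B := Real.sqrt (ξ ^ 2 + M ^ 2) with hB
  have hA2 : A ^ 2 = ξ ^ 2 + D ^ 2 := Real.sq_sqrt (by positivity)
  have hB2 : B ^ 2 = ξ ^ 2 + M ^ 2 := Real.sq_sqrt (by positivity)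
  have hBpos : 0 < B := Real.sqrt_pos.2 (by positivity)
  have hξA : |ξ| ≤ A := by
    rw [← Real.sqrt_sq_eq_abs]
    exact Real.sqrt_le_sqrt (by nlinarith)
  have hAB : A ≤ B := Real.sqrt_le_sqrt (by nlinarith)
  rw [div_le_iff₀ (by positivity)]
  have h0 : 0 ≤ A - |ξ| := by linarith
  have h1 : 0 ≤ 2 * B - A - |ξ| := by linarith
  have habs : |ξ| ^ 2 = ξ ^ 2 := sq_abs ξ
  nlinarith [mul_nonneg h0 h1]

/-! ### Dictionary: the torus objects in coordinates -/

/-- `ε_L(a, b) = -2cos(2πa/L) - 2cos(2πb/L)` (private copy of a tree dictionary lemma). [folklore] -/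
private theorem flc_torusBand_vecCons {L : ℕ} (a b : ZMod L) :
    torusBand L ![a, b] =
      -2 * Real.cos (2 * π * (a.val : ℝ) / L) - 2 * Real.cos (2 * π * (b.val : ℝ) / L) := by
  simp only [torusBand, latticeMomentum, Fin.sum_univ_two, Matrix.cons_val_zero,
    Matrix.cons_val_one]
  ring

/-- `ĝ_d(a, b) = cos(2πa/L) - cos(2πb/L)` (private copy of a tree dictionary lemma). [folklore] -/
private theorem flc_dWaveGap_vecCons {L : ℕ} (a b : ZMod L) :
    dWaveGap ![a, b] = Real.cos (2 * π * (a.val : ℝ) / L) - Real.cos (2 * π * (b.val : ℝ) / L) := by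
  simp only [dWaveGap, latticeMomentum, Matrix.cons_val_zero, Matrix.cons_val_one]

/-! ### One transversal row of the torus, any `μ` -/

/-- **One transversal row.** For `0 < κ`, `0 < s ≤ 1`, `L ≥ 400/s²`, `0 < h < (πs²/32)²`, `L ≥ 8π/h`,
every row `k₂ = b` of the momentum grid with `2κ ≤ 2cos(2πb/L) + μ/2` and
`|2cos(2πb/L) + μ| ≤ 2 − s²/2` carries `κ²L log(1/h)/(2π)` of the weighted regulated Cooper sum
`Σ_a ĝ_d(a,b)²/√((ε_L(a,b) − μ)² + h²)`: along the row, wherever `ε_L ≥ μ`, `ĝ_d ≤ −2κ`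
(the one-row harmonic walk `dWaveCooperRow_sum_ge`). [cite: Salmhofer1999, §4.5.4] -/
theorem dWaveCooper_transversalRow_sum_ge {L : ℕ} [NeZero L] {κ s μ h : ℝ} (hκ : 0 < κ)
    (hs : 0 < s) (hs1 : s ≤ 1) (hh : 0 < h) (hhq : h < (π * s ^ 2 / 32) ^ 2)
    (hL : 400 / s ^ 2 ≤ (L : ℝ)) (hLh : 8 * π / h ≤ (L : ℝ)) (b : ZMod L)
    (hb1 : 2 * κ ≤ 2 * Real.cos (2 * π * (b.val : ℝ) / L) + μ / 2)
    (hb2 : |2 * Real.cos (2 * π * (b.val : ℝ) / L) + μ| ≤ 2 - s ^ 2 / 2) :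
    κ ^ 2 * L / (2 * π) * Real.log (1 / h) ≤
      ∑ a : ZMod L, dWaveGap ![a, b] ^ 2 / Real.sqrt ((torusBand L ![a, b] - μ) ^ 2 + h ^ 2) := by
  set C₂ : ℝ := Real.cos (2 * π * (b.val : ℝ) / L) with hC₂
  set c : ℝ := -2 * C₂ - μ with hc
  have hc' : |c| ≤ 2 - s ^ 2 / 2 := by
    rw [hc, show -2 * C₂ - μ = -(2 * C₂ + μ) by ring, abs_neg]
    exact hb2
  have key := dWaveCooperRow_sum_ge (κ := κ) (fun n : ℕ => -2 * Real.cos (2 * π * (n : ℝ) / L) + c)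
    (fun n : ℕ => Real.cos (2 * π * (n : ℝ) / L) - C₂) (fun n => rfl) hs hs1 hc' hL hh hhq hLh ?_
  · refine key.trans (le_of_eq ?_)
    refine Finset.sum_nbij (fun n : ℕ => (n : ZMod L)) (fun n _ => Finset.mem_univ _) ?_ ?_ ?_
    · intro n hn m hm h
      have hn' : n < L := by simpa using hn
      have hm' : m < L := by simpa using hm
      have := congrArg ZMod.val h
      rwa [ZMod.val_cast_of_lt hn', ZMod.val_cast_of_lt hm'] at this
    · intro a _
      exact ⟨a.val, by simpa using ZMod.val_lt a, ZMod.natCast_zmod_val a⟩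
    · intro n hn
      have hn' : n < L := by simpa using hn
      have e : -2 * Real.cos (2 * π * (n : ℝ) / L) + c =
          -2 * Real.cos (2 * π * (n : ℝ) / L) - 2 * C₂ - μ := by rw [hc]; ring
      simp only [flc_torusBand_vecCons, flc_dWaveGap_vecCons, ZMod.val_cast_of_lt hn', e, hC₂]
  · intro n hgn
    have h1 : Real.cos (2 * π * (n : ℝ) / L) - C₂ ≤ -2 * κ := by
      simp only [hc] at hgn
      linarith
    nlinarith

/-! ### Assembly over a window of transversal rows -/

/-- **The `d`-wave Cooper logarithm on the torus over a window of rows, quantitative form.** If the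
window `cos k₂ ∈ [a, a + s²/8] ⊂ [−1 + s²/8, 1]` consists of transversal rows
(`2κ ≤ 2a + μ/2`, `−2 + s²/2 ≤ 2a + μ`, `2a + s²/4 + μ ≤ 2 − s²/2`), then its `≥ s²L/(32π)` rows give
`Σ_k ĝ_d(k)²/√((ε_L(k) − μ)² + h²) ≥ (s²κ²/(64π²)) log(1/h) L²`. [cite: Salmhofer1999, §4.5.4] -/
theorem dWaveCooper_window_sum_ge {L : ℕ} [NeZero L] {κ s μ h a : ℝ} (hκ : 0 < κ)
    (hs : 0 < s) (hs1 : s ≤ 1) (hh : 0 < h) (hhq : h < (π * s ^ 2 / 32) ^ 2)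
    (hL : 400 / s ^ 2 ≤ (L : ℝ)) (hLh : 8 * π / h ≤ (L : ℝ))
    (ha1 : -1 + s ^ 2 / 8 ≤ a) (ha2 : a + s ^ 2 / 8 ≤ 1)
    (hw1 : 2 * κ ≤ 2 * a + μ / 2) (hw2 : -2 + s ^ 2 / 2 ≤ 2 * a + μ)
    (hw3 : 2 * a + s ^ 2 / 4 + μ ≤ 2 - s ^ 2 / 2) :
    s ^ 2 * κ ^ 2 / (64 * π ^ 2) * Real.log (1 / h) * (L : ℝ) ^ 2 ≤
      ∑ k : TorusSite 2 L, dWaveGap k ^ 2 / Real.sqrt ((torusBand L k - μ) ^ 2 + h ^ 2) := by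
  have hπ := Real.pi_pos
  have hL1 : 1 ≤ L := Nat.pos_of_ne_zero (NeZero.ne L)
  -- `h ≤ 1`, so `log(1/h) ≥ 0`
  have hq1 : π * s ^ 2 / 32 < 1 := by
    have hs2 : s ^ 2 ≤ 1 := by nlinarith
    nlinarith [Real.pi_lt_four]
  have hh1 : h ≤ 1 := by
    have : (π * s ^ 2 / 32) ^ 2 < 1 := by
      have hq0 : 0 < π * s ^ 2 / 32 := by positivity
      nlinarith
    linarith
  have hlog : 0 ≤ Real.log (1 / h) := Real.log_nonneg (by rw [le_div_iff₀ hh]; linarith)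
  -- the window rows
  set W : Finset ℕ := (Finset.range (L / 2 + 1)).filter fun n : ℕ =>
      a ≤ Real.cos (2 * π * (n : ℝ) / L) ∧ Real.cos (2 * π * (n : ℝ) / L) ≤ a + s ^ 2 / 8 with hW
  have hWcard : s ^ 2 * L / (32 * π) ≤ (W.card : ℝ) := card_windowRows_ge hs hs1 hL ha1 ha2
  have hWlt : ∀ n ∈ W, n < L := by
    intro n hn
    rw [hW, Finset.mem_filter, Finset.mem_range] at hn
    omega
  have hWcos : ∀ n ∈ W, a ≤ Real.cos (2 * π * (n : ℝ) / L) ∧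
      Real.cos (2 * π * (n : ℝ) / L) ≤ a + s ^ 2 / 8 := by
    intro n hn
    rw [hW, Finset.mem_filter] at hn
    exact hn.2
  set WB : Finset (ZMod L) := W.image fun n : ℕ => (n : ZMod L) with hWB
  have hinj : Set.InjOn (fun n : ℕ => (n : ZMod L)) ↑W := by
    intro n hn m hm h
    have := congrArg ZMod.val h
    rwa [ZMod.val_cast_of_lt (hWlt n hn), ZMod.val_cast_of_lt (hWlt m hm)] at this
  have hWBcard : (WB.card : ℝ) = W.card := by
    rw [hWB, Finset.card_image_of_injOn hinj]
  -- the momentum-space function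
  set F : TorusSite 2 L → ℝ := fun k =>
    dWaveGap k ^ 2 / Real.sqrt ((torusBand L k - μ) ^ 2 + h ^ 2) with hF
  have hFnn : ∀ k, 0 ≤ F k := fun k => by positivity
  have hrow : ∀ b ∈ WB, κ ^ 2 * L / (2 * π) * Real.log (1 / h) ≤ ∑ a : ZMod L, F ![a, b] := by
    intro b hb
    rw [hWB, Finset.mem_image] at hb
    obtain ⟨n, hn, rfl⟩ := hb
    obtain ⟨hc1, hc2⟩ := hWcos n hn
    apply dWaveCooper_transversalRow_sum_ge hκ hs hs1 hh hhq hL hLh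
    · rw [ZMod.val_cast_of_lt (hWlt n hn)]
      linarith
    · rw [ZMod.val_cast_of_lt (hWlt n hn), abs_le]
      constructor <;> linarith
  -- the chain
  calc s ^ 2 * κ ^ 2 / (64 * π ^ 2) * Real.log (1 / h) * (L : ℝ) ^ 2
      = (s ^ 2 * L / (32 * π)) * (κ ^ 2 * L / (2 * π) * Real.log (1 / h)) := by ring
    _ ≤ (WB.card : ℝ) * (κ ^ 2 * L / (2 * π) * Real.log (1 / h)) := by
        rw [hWBcard]
        exact mul_le_mul_of_nonneg_right hWcard (mul_nonneg (by positivity) hlog)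
    _ = ∑ b ∈ WB, κ ^ 2 * L / (2 * π) * Real.log (1 / h) := by
        rw [Finset.sum_const, nsmul_eq_mul]
    _ ≤ ∑ b ∈ WB, ∑ a : ZMod L, F ![a, b] := Finset.sum_le_sum hrow
    _ ≤ ∑ b : ZMod L, ∑ a : ZMod L, F ![a, b] :=
        Finset.sum_le_sum_of_subset_of_nonneg (Finset.subset_univ _) fun b _ _ =>
          Finset.sum_nonneg fun a _ => hFnn _
    _ = ∑ k, F k := (sum_torusSite_two_eq F).symm

/-- **The `d`-wave-weighted zero-temperature Cooper logarithm on the torus, every `μ` inside the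
band.** For `μ ∈ (-4, 4)` there are `c, h₁ > 0` such that for every `h ∈ (0, h₁)`, eventually in `L`
(ALL sides, odd included), `Σ_{k ∈ (ℤ/Lℤ)²} ĝ_d(k)²/√((ε_L(k) − μ)² + h²) ≥ c log(1/h) L²`. Here
`r = min(4+μ, 4−μ)/8`, `s = r/2`, `κ = r/4`, `c = s²κ²/(64π²)`, `h₁ = (πs²/32)²`, window
`a = −μ/4 + r/2` (`dWaveCooper_window_sum_ge`). [cite: Salmhofer1999, §4.5.4] -/
theorem dWaveCooperSum_ge_of_mem_Ioo {μ : ℝ} (hμ : μ ∈ Set.Ioo (-4 : ℝ) 4) :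
    ∃ c : ℝ, 0 < c ∧ ∃ h₁ : ℝ, 0 < h₁ ∧ ∀ h ∈ Set.Ioo 0 h₁, ∃ L₀ : ℕ, ∀ (L : ℕ) [NeZero L], L₀ ≤ L →
      c * Real.log (1 / h) * (L : ℝ) ^ 2 ≤
        ∑ k : TorusSite 2 L, dWaveGap k ^ 2 / Real.sqrt ((torusBand L k - μ) ^ 2 + h ^ 2) := by
  obtain ⟨hμ1, hμ2⟩ := hμ
  have hπ := Real.pi_pos
  set r : ℝ := min (4 + μ) (4 - μ) / 8 with hr
  have hr1 : r ≤ (4 + μ) / 8 := by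
    rw [hr]; exact div_le_div_of_nonneg_right (min_le_left _ _) (by norm_num)
  have hr2 : r ≤ (4 - μ) / 8 := by
    rw [hr]; exact div_le_div_of_nonneg_right (min_le_right _ _) (by norm_num)
  have hr0 : 0 < r := by
    rw [hr]
    have : 0 < min (4 + μ) (4 - μ) := lt_min (by linarith) (by linarith)
    positivity
  have hrh : r ≤ 1 / 2 := by linarith
  set s : ℝ := r / 2 with hs
  set κ : ℝ := r / 4 with hκ
  set a : ℝ := -μ / 4 + r / 2 with ha
  have hs0 : 0 < s := by positivity
  have hs1 : s ≤ 1 := by linarith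
  have hκ0 : 0 < κ := by positivity
  have hss : s ^ 2 ≤ r / 8 := by rw [hs]; nlinarith
  refine ⟨s ^ 2 * κ ^ 2 / (64 * π ^ 2), by positivity, (π * s ^ 2 / 32) ^ 2, by positivity, ?_⟩
  intro h hh
  refine ⟨⌈max (400 / s ^ 2) (8 * π / h)⌉₊, fun L _ hL => ?_⟩
  have hL' : max (400 / s ^ 2) (8 * π / h) ≤ (L : ℝ) := Nat.ceil_le.mp hL
  refine dWaveCooper_window_sum_ge (a := a) hκ0 hs0 hs1 hh.1 hh.2 ((le_max_left _ _).trans hL')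
    ((le_max_right _ _).trans hL') ?_ ?_ ?_ ?_ ?_
  · rw [ha]; nlinarith
  · rw [ha]; nlinarith
  · rw [ha, hκ]; nlinarith
  · rw [ha]; nlinarith
  · rw [ha]; nlinarith

/-! ### The item -/

/-- **`FreeCooperLogarithm` (item `stmt-HubbardSuperconductivity-1898`, route `DeformationLadder`).**
For `μ ∈ (-4, 4)` and `g > 0` there are `h₀ > 0`, `ε > 0` and `L₀` such that for every `L ≥ L₀`,
`E₀(dWaveSourceTorus L 0 μ h₀) + (h₀²/g + ε) L² ≤ E₀(dWaveSourceTorus L 0 μ 0)`: the free (`U = 0`)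
BdG energy gain of the `d`-wave pair source beats any quadratic price `h₀²/g` for small `h₀`, by the
Cooper logarithm. With `c, h₁` from `dWaveCooperSum_ge_of_mem_Ioo`: `K = (1/g + 1)/(4c)`,
`h' = min(e^{−K}, h₁/2)`, `h₀ = h'/(4√2)`, `ε = h₀²`, `L₀ = max 3 L₀(h')`. [folklore] -/
theorem freeCooperLogarithm_proof : FreeCooperLogarithm := by
  intro μ hμ g hg
  obtain ⟨c, hc, h₁, hh₁, hA⟩ := dWaveCooperSum_ge_of_mem_Ioo hμ
  set K : ℝ := (1 / g + 1) / (4 * c) with hK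
  set h' : ℝ := min (Real.exp (-K)) (h₁ / 2) with hh'
  have hh'0 : 0 < h' := lt_min (Real.exp_pos _) (by positivity)
  have hh'1 : h' < h₁ := (min_le_right _ _).trans_lt (by linarith)
  have hlogK : K ≤ Real.log (1 / h') := by
    rw [one_div, Real.log_inv]
    have : Real.log h' ≤ -K := by
      calc Real.log h' ≤ Real.log (Real.exp (-K)) := Real.log_le_log hh'0 (min_le_left _ _)
        _ = -K := Real.log_exp _
    linarith
  have hcK : 1 / g + 1 ≤ 4 * c * Real.log (1 / h') := by
    have h4c : (0 : ℝ) < 4 * c := by positivity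
    rw [hK, div_le_iff₀ h4c] at hlogK
    linarith
  have hsqrt2 : (0 : ℝ) < Real.sqrt 2 := Real.sqrt_pos.2 (by norm_num)
  have hsq2 : Real.sqrt 2 ^ 2 = 2 := Real.sq_sqrt zero_le_two
  set h : ℝ := h' / (4 * Real.sqrt 2) with hhdef
  have hh0 : 0 < h := by positivity
  have hh'eq : h' = 4 * Real.sqrt 2 * h := by
    rw [hhdef]; field_simp
  have hh'sq : h' ^ 2 = 32 * h ^ 2 := by
    rw [hh'eq, mul_pow, mul_pow, hsq2]; ring
  obtain ⟨L₀, hL₀⟩ := hA h' ⟨hh'0, hh'1⟩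
  refine ⟨h, hh0, h ^ 2, by positivity, max 3 L₀, fun L _ hL => ?_⟩
  have hL3 : 3 ≤ L := le_of_max_le_left hL
  have hsum := hL₀ L (le_of_max_le_right hL)
  rw [stub_freeSourcedGroundEnergy L hL3 μ h, stub_freeSourcedGroundEnergy L hL3 μ 0]
  -- per-mode bound
  have hmode : ∀ k : TorusSite 2 L,
      4 * h ^ 2 * (dWaveGap k ^ 2 / Real.sqrt ((torusBand L k - μ) ^ 2 + h' ^ 2)) ≤
        Real.sqrt ((torusBand L k - μ) ^ 2 + (2 * Real.sqrt 2 * h * dWaveGap k) ^ 2) -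
          Real.sqrt ((torusBand L k - μ) ^ 2 + (2 * Real.sqrt 2 * 0 * dWaveGap k) ^ 2) := by
    intro k
    have e0 : (torusBand L k - μ) ^ 2 + (2 * Real.sqrt 2 * 0 * dWaveGap k) ^ 2 =
        (torusBand L k - μ) ^ 2 := by ring
    rw [e0, Real.sqrt_sq_eq_abs]
    have e1 : (2 * Real.sqrt 2 * h * dWaveGap k) ^ 2 = 8 * h ^ 2 * dWaveGap k ^ 2 := by
      rw [mul_pow, mul_pow, mul_pow, hsq2]; ring
    have hg2 : dWaveGap k ^ 2 ≤ 4 := by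
      have hg := abs_dWaveGap_le k
      rw [← sq_abs]; nlinarith [abs_nonneg (dWaveGap k)]
    have hDM : (2 * Real.sqrt 2 * h * dWaveGap k) ^ 2 ≤ h' ^ 2 := by
      rw [e1, hh'sq]; nlinarith [sq_nonneg h]
    have key := bdgGain_ge (ξ := torusBand L k - μ) hh'0 hDM
    have hS : 0 < Real.sqrt ((torusBand L k - μ) ^ 2 + h' ^ 2) := Real.sqrt_pos.2 (by positivity)
    have e2 : 4 * h ^ 2 * (dWaveGap k ^ 2 / Real.sqrt ((torusBand L k - μ) ^ 2 + h' ^ 2)) =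
        (2 * Real.sqrt 2 * h * dWaveGap k) ^ 2 /
          (2 * Real.sqrt ((torusBand L k - μ) ^ 2 + h' ^ 2)) := by
      rw [e1]; field_simp; ring
    rw [e2]
    exact key
  have hgain : 4 * h ^ 2 * (c * Real.log (1 / h') * (L : ℝ) ^ 2) ≤
      ∑ k : TorusSite 2 L, (Real.sqrt ((torusBand L k - μ) ^ 2 + (2 * Real.sqrt 2 * h * dWaveGap k) ^ 2) -
        Real.sqrt ((torusBand L k - μ) ^ 2 + (2 * Real.sqrt 2 * 0 * dWaveGap k) ^ 2)) := by
    calc 4 * h ^ 2 * (c * Real.log (1 / h') * (L : ℝ) ^ 2)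
        ≤ 4 * h ^ 2 * ∑ k : TorusSite 2 L,
            dWaveGap k ^ 2 / Real.sqrt ((torusBand L k - μ) ^ 2 + h' ^ 2) :=
          mul_le_mul_of_nonneg_left hsum (by positivity)
      _ = ∑ k : TorusSite 2 L,
            4 * h ^ 2 * (dWaveGap k ^ 2 / Real.sqrt ((torusBand L k - μ) ^ 2 + h' ^ 2)) := by
          rw [Finset.mul_sum]
      _ ≤ _ := Finset.sum_le_sum fun k _ => hmode k
  have hdiff : (∑ k : TorusSite 2 L, ((torusBand L k - μ) -
        Real.sqrt ((torusBand L k - μ) ^ 2 + (2 * Real.sqrt 2 * 0 * dWaveGap k) ^ 2))) -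
      ∑ k : TorusSite 2 L, ((torusBand L k - μ) -
        Real.sqrt ((torusBand L k - μ) ^ 2 + (2 * Real.sqrt 2 * h * dWaveGap k) ^ 2)) =
      ∑ k : TorusSite 2 L, (Real.sqrt ((torusBand L k - μ) ^ 2 + (2 * Real.sqrt 2 * h * dWaveGap k) ^ 2) -
        Real.sqrt ((torusBand L k - μ) ^ 2 + (2 * Real.sqrt 2 * 0 * dWaveGap k) ^ 2)) := by
    rw [← Finset.sum_sub_distrib]
    exact Finset.sum_congr rfl fun k _ => by ring
  have hL2 : (0 : ℝ) ≤ (L : ℝ) ^ 2 := by positivity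
  have hprice : (h ^ 2 / g + h ^ 2) * (L : ℝ) ^ 2 ≤ 4 * h ^ 2 * (c * Real.log (1 / h') * (L : ℝ) ^ 2) := by
    have e : (h ^ 2 / g + h ^ 2) * (L : ℝ) ^ 2 = h ^ 2 * (1 / g + 1) * (L : ℝ) ^ 2 := by ring
    rw [e, show 4 * h ^ 2 * (c * Real.log (1 / h') * (L : ℝ) ^ 2) =
      h ^ 2 * (4 * c * Real.log (1 / h')) * (L : ℝ) ^ 2 by ring]
    exact mul_le_mul_of_nonneg_right (mul_le_mul_of_nonneg_left hcK (by positivity)) hL2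
  linarith

end Summit.HubbardSuperconductivity.DeformationLadder

end
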